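import Literature.MeasureTheory.Hausdorff.CylinderHausdorffFinite
import Literature.MeasureTheory.Hausdorff.UniformlyDistributedSigmaFinite
import Literature.MeasureTheory.Hausdorff.SphereMeasure
import HarnessLib

/-!
# The Hausdorff measure of a round cylinder is proportional to the product measure

Setting: `E` a real inner product space of dimension `n + 1`, `V ≤ E` a subspace of dimension
`k + 1` (`k ≥ 1`), `Cyl = {z | ‖P_V z‖ = 1}` the round unit cylinder over `V` (`≅ S^k × ℝ^{n-k}`),
`f : V × Vᗮ → E` the addition map and
`ν = f_* (μHE[k]⌊S_V ⊗ vol_{Vᗮ})` the product of the spherical Hausdorff measure of the unit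
sphere `S_V` of `V` with the Lebesgue measure of `Vᗮ`, transported to `E`.

Main result (`exists_euclideanHausdorff_restrict_cylinder_eq_smul`):
**`μHE[n]⌊Cyl = c • ν` for a constant `c < ∞`.** Both measures, pulled back to the metric space
`Cyl`, are *uniformly distributed*: the group of isometries `z ↦ A (P_V z) + P_{Vᗮ} z + b`
(`A` a linear isometry of `V`, `b ∈ Vᗮ`) preserves `Cyl`, acts transitively on it
(`exists_isometryEquiv_cylinder`) and preserves both `μHE[n]` (isometry invariance) and `ν`
(`map_cylinderIsometry_productMeasure`); balls have finite measure
(`CylinderHausdorffFinite.lean`, and `ν (B) ≤ μHE[k](S_V) vol (B)`), and `ν ≠ 0`. Christensen's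
lemma (`UniformlyDistributedSigmaFinite.lean`) gives the proportionality on `Cyl`, which is then
pushed forward to `E`. The value `c = 1` is proved in `CylinderHausdorffProduct.lean`.
Support for `Literature.Geometry.Riemannian.Stone1994_cylinderEntropy`.

## References

* P. Mattila, *Geometry of sets and measures in Euclidean spaces* (1995), Thm. 3.4.
* H. Federer, *Geometric measure theory* (1969), 2.7.16, 3.2.23.
-/

noncomputable section

open Set Metric Module Submodule Filter Function
open _root_.MeasureTheory _root_.MeasureTheory.Measure
open scoped ENNReal NNReal Topology RealInnerProductSpace Pointwise

namespace Literature.MeasureTheory.Hausdorff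

variable {E : Type*} [NormedAddCommGroup E] [InnerProductSpace ℝ E] [FiniteDimensional ℝ E]

/-! ### Isometries of the cylinder -/

section Isometries

variable (V : Submodule ℝ E)

/-- **The linear isometries `z ↦ A (P_V z) + P_{Vᗮ} z` of `E`** induced by a linear isometry `A`
of `V` (identity on `Vᗮ`). [folklore] -/
theorem exists_linearIsometryEquiv_extend (A : V ≃ₗᵢ[ℝ] V) :
    ∃ L : E ≃ₗᵢ[ℝ] E, ∀ z : E,
      L z = (A (V.orthogonalProjectionOnto z) : E) + (Vᗮ.orthogonalProjectionOnto z : E) := by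
  set T : E →ₗ[ℝ] E :=
    (V.subtype.comp (A.toLinearEquiv.toLinearMap.comp V.orthogonalProjectionOnto.toLinearMap)) +
      (Vᗮ.subtype.comp Vᗮ.orthogonalProjectionOnto.toLinearMap) with hT_def
  have hT : ∀ z : E, T z = (A (V.orthogonalProjectionOnto z) : E) + (Vᗮ.orthogonalProjectionOnto z : E) :=
    fun z ↦ rfl
  have hnorm : ∀ z : E, ‖T z‖ = ‖z‖ := by
    intro z
    have h0 : ⟪(A (V.orthogonalProjectionOnto z) : E), (Vᗮ.orthogonalProjectionOnto z : E)⟫ = 0 :=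
      Submodule.inner_right_of_mem_orthogonal (A (V.orthogonalProjectionOnto z)).2
        (Vᗮ.orthogonalProjectionOnto z).2
    have h1 := norm_add_sq_eq_norm_sq_add_norm_sq_of_inner_eq_zero _ _ h0
    have h2 := norm_sq_eq_add_norm_sq_projection z V
    have h3 : ‖(A (V.orthogonalProjectionOnto z) : E)‖ = ‖V.orthogonalProjectionOnto z‖ := by
      rw [show ‖(A (V.orthogonalProjectionOnto z) : E)‖ = ‖A (V.orthogonalProjectionOnto z)‖ from rfl,
        A.norm_map]
    have h4 : ‖(Vᗮ.orthogonalProjectionOnto z : E)‖ = ‖Vᗮ.orthogonalProjectionOnto z‖ := rfl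
    rw [hT, ← Real.sqrt_sq (norm_nonneg (_ + _)), sq, h1, h3, h4, ← sq, ← sq, ← h2,
      Real.sqrt_sq (norm_nonneg z)]
  set Li : E →ₗᵢ[ℝ] E := ⟨T, hnorm⟩ with hLi
  exact ⟨Li.toLinearIsometryEquiv rfl, fun z ↦ hT z⟩

/-- Such an isometry followed by a translation along `Vᗮ` preserves the height `‖P_V z‖`; in
particular it maps the cylinder `{‖P_V z‖ = 1}` onto itself. [folklore] -/
theorem norm_orthogonalProjectionOnto_cylinderIsometry (A : V ≃ₗᵢ[ℝ] V) {L : E ≃ₗᵢ[ℝ] E}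
    (hL : ∀ z : E, L z = (A (V.orthogonalProjectionOnto z) : E) + (Vᗮ.orthogonalProjectionOnto z : E))
    (b : Vᗮ) (z : E) :
    ‖V.orthogonalProjectionOnto (L z + (b : E))‖ = ‖V.orthogonalProjectionOnto z‖ := by
  rw [hL, map_add, map_add, orthogonalProjectionOnto_mem_subspace_eq_self,
    orthogonalProjectionOnto_apply_of_mem_orthogonal (Vᗮ.orthogonalProjectionOnto z).2,
    orthogonalProjectionOnto_apply_of_mem_orthogonal b.2, add_zero, add_zero, A.norm_map]

/-- **Transitivity**: for two points `x, y` of the cylinder `{‖P_V z‖ = 1}` there is an isometry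
of `E` of the form `z ↦ A (P_V z) + P_{Vᗮ} z + b` (`A` a linear isometry of `V`, `b ∈ Vᗮ`)
taking `x` to `y` (`A` = a reflection of `V` taking `P_V x` to `P_V y`, `b = P_{Vᗮ} y - P_{Vᗮ} x`).
[folklore] -/
theorem exists_isometryEquiv_cylinder {x y : E} (hx : ‖V.orthogonalProjectionOnto x‖ = 1)
    (hy : ‖V.orthogonalProjectionOnto y‖ = 1) :
    ∃ (A : V ≃ₗᵢ[ℝ] V) (L : E ≃ₗᵢ[ℝ] E) (b : Vᗮ),
      (∀ z : E, L z = (A (V.orthogonalProjectionOnto z) : E) + (Vᗮ.orthogonalProjectionOnto z : E)) ∧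
      L x + (b : E) = y := by
  obtain ⟨A, hA⟩ := exists_linearIsometryEquiv_apply_eq
    (⟨V.orthogonalProjectionOnto x, mem_sphere_zero_iff_norm.2 hx⟩ : sphere (0 : V) 1)
    ⟨V.orthogonalProjectionOnto y, mem_sphere_zero_iff_norm.2 hy⟩
  obtain ⟨L, hL⟩ := exists_linearIsometryEquiv_extend V A
  refine ⟨A, L, Vᗮ.orthogonalProjectionOnto y - Vᗮ.orthogonalProjectionOnto x, hL, ?_⟩
  simp only at hA
  rw [hL, hA, Submodule.coe_sub]
  have key := starProjection_add_starProjection_orthogonal (K := V) y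
  rw [starProjection_apply, starProjection_apply] at key
  calc (V.orthogonalProjectionOnto y : E) + (Vᗮ.orthogonalProjectionOnto x : E) +
        ((Vᗮ.orthogonalProjectionOnto y : E) - (Vᗮ.orthogonalProjectionOnto x : E))
      = (V.orthogonalProjectionOnto y : E) + (Vᗮ.orthogonalProjectionOnto y : E) := by abel
    _ = y := key

end Isometries

/-! ### Invariance of the product measure -/

section ProductMeasure

variable (V : Submodule ℝ E) [MeasurableSpace E] [BorelSpace E]

omit [FiniteDimensional ℝ E] in
/-- A linear isometry of `V` preserves `μHE[k]⌊S_V`. [folklore] -/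
theorem map_linearIsometryEquiv_restrict_sphere (A : V ≃ₗᵢ[ℝ] V) (k : ℕ) :
    Measure.map A ((μHE[k] : Measure V).restrict (sphere 0 1)) =
      (μHE[k] : Measure V).restrict (sphere 0 1) := by
  have hpre : A ⁻¹' sphere (0 : V) 1 = sphere 0 1 := by
    ext a; simp
  have h1 : Measure.map A ((μHE[k] : Measure V).restrict (sphere 0 1)) =
      (Measure.map A (μHE[k] : Measure V)).restrict (sphere 0 1) := by
    rw [Measure.restrict_map A.continuous.measurable isClosed_sphere.measurableSet, hpre]
  rw [h1, A.isometry.map_euclideanHausdorffMeasure, Set.range_eq_univ.2 A.surjective,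
    Measure.restrict_univ]

/-- **The product measure is invariant under the isometries of the cylinder**: for
`g z = L z + b` with `L z = A (P_V z) + P_{Vᗮ} z`,
`g_* ν = ν` where `ν = f_* (μHE[k]⌊S_V ⊗ vol_{Vᗮ})`, `f (a, b) = a + b` (indeed
`g ∘ f = f ∘ (A × (· + b))`, and both factors are invariant). [folklore] -/
theorem map_cylinderIsometry_productMeasure (A : V ≃ₗᵢ[ℝ] V) {L : E ≃ₗᵢ[ℝ] E}
    (hL : ∀ z : E, L z = (A (V.orthogonalProjectionOnto z) : E) + (Vᗮ.orthogonalProjectionOnto z : E))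
    (b : Vᗮ) (k : ℕ) [SFinite ((μHE[k] : Measure V).restrict (sphere 0 1))] :
    Measure.map (fun z : E ↦ L z + (b : E))
      (Measure.map (fun p : V × Vᗮ ↦ (p.1 : E) + (p.2 : E))
        (((μHE[k] : Measure V).restrict (sphere 0 1)).prod (volume : Measure Vᗮ))) =
      Measure.map (fun p : V × Vᗮ ↦ (p.1 : E) + (p.2 : E))
        (((μHE[k] : Measure V).restrict (sphere 0 1)).prod (volume : Measure Vᗮ)) := by
  have hf : Measurable (fun p : V × Vᗮ ↦ (p.1 : E) + (p.2 : E)) := by fun_prop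
  have hg : Measurable (fun z : E ↦ L z + (b : E)) := by fun_prop
  have hG : Measurable (Prod.map A (fun w : Vᗮ ↦ w + b)) := by fun_prop
  have hcomm : (fun z : E ↦ L z + (b : E)) ∘ (fun p : V × Vᗮ ↦ (p.1 : E) + (p.2 : E)) =
      (fun p : V × Vᗮ ↦ (p.1 : E) + (p.2 : E)) ∘ Prod.map A (fun w : Vᗮ ↦ w + b) := by
    funext p
    show L ((p.1 : E) + (p.2 : E)) + (b : E) = ((A p.1 : V) : E) + ((p.2 + b : Vᗮ) : E)
    rw [hL, map_add V.orthogonalProjectionOnto, map_add Vᗮ.orthogonalProjectionOnto,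
      orthogonalProjectionOnto_mem_subspace_eq_self,
      orthogonalProjectionOnto_apply_of_mem_orthogonal p.2.2, add_zero,
      orthogonalProjectionOnto_orthogonal_apply_eq_zero p.1.2, zero_add,
      orthogonalProjectionOnto_mem_subspace_eq_self, Submodule.coe_add]
    abel
  rw [Measure.map_map hg hf, hcomm, ← Measure.map_map hf hG]
  congr 1
  rw [← Measure.map_prod_map _ _ A.continuous.measurable (by fun_prop),
    map_linearIsometryEquiv_restrict_sphere V A k, map_add_right_eq_self]

end ProductMeasure

/-! ### Both measures are uniformly distributed on the cylinder; proportionality -/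

section Proportional

variable (V : Submodule ℝ E) [MeasurableSpace E] [BorelSpace E]

omit [MeasurableSpace E] [BorelSpace E] in
/-- Balls of the cylinder (for the induced metric) are traces of balls of `E`. [folklore] -/
theorem image_val_ball_cylinder (x : {z : E | ‖V.orthogonalProjectionOnto z‖ = 1}) (r : ℝ) :
    (Subtype.val : {z : E | ‖V.orthogonalProjectionOnto z‖ = 1} → E) '' ball x r =
      {z : E | ‖V.orthogonalProjectionOnto z‖ = 1} ∩ ball (x : E) r := by
  have h : ball x r = (Subtype.val : {z : E | ‖V.orthogonalProjectionOnto z‖ = 1} → E) ⁻¹'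
      ball (x : E) r := by
    ext z; rfl
  rw [h, Subtype.image_preimage_coe]

/-- The cylinder is a closed, hence measurable, set. [folklore] -/
theorem measurableSet_cylinder : MeasurableSet {z : E | ‖V.orthogonalProjectionOnto z‖ = 1} :=
  (isClosed_eq (V.orthogonalProjectionOnto.continuous.norm) continuous_const).measurableSet

omit [MeasurableSpace E] [BorelSpace E] in
/-- **Transport of traces of balls by the isometries of the cylinder.** [folklore] -/
theorem image_cylinder_inter_ball (A : V ≃ₗᵢ[ℝ] V) {L : E ≃ₗᵢ[ℝ] E}
    (hL : ∀ z : E, L z = (A (V.orthogonalProjectionOnto z) : E) + (Vᗮ.orthogonalProjectionOnto z : E))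
    (b : Vᗮ) (x : E) (r : ℝ) :
    (fun z : E ↦ L z + (b : E)) '' ({z : E | ‖V.orthogonalProjectionOnto z‖ = 1} ∩ ball x r) =
      {z : E | ‖V.orthogonalProjectionOnto z‖ = 1} ∩ ball (L x + (b : E)) r := by
  set g : E ≃ᵢ E := L.toIsometryEquiv.trans (IsometryEquiv.addRight (b : E)) with hg_def
  have hg : ∀ z, g z = L z + (b : E) := fun z ↦ rfl
  have hfun : (fun z : E ↦ L z + (b : E)) = g := funext fun z ↦ (hg z).symm
  rw [hfun, Set.image_inter g.injective, g.image_ball, hg x]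
  congr 1
  ext w
  simp only [mem_image, mem_setOf_eq]
  constructor
  · rintro ⟨z, hz, rfl⟩
    rw [hg, norm_orthogonalProjectionOnto_cylinderIsometry V A hL b z]
    exact hz
  · intro hw
    refine ⟨g.symm w, ?_, g.apply_symm_apply w⟩
    have := norm_orthogonalProjectionOnto_cylinderIsometry V A hL b (g.symm w)
    rw [← hg, g.apply_symm_apply] at this
    rw [← this]
    exact hw

/-- **Proportionality on the cylinder** (Christensen's lemma): for `dim E = n + 1`,
`dim V = k + 1`, `k ≥ 1`, there is `c < ∞` with `μHE[n]⌊Cyl = c • ν`,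
`ν = f_* (μHE[k]⌊S_V ⊗ vol_{Vᗮ})`. [cite: Mattila1995, Thm. 3.4] -/
theorem exists_euclideanHausdorff_restrict_cylinder_eq_smul {n k : ℕ} (hE : finrank ℝ E = n + 1)
    (hV : finrank ℝ V = k + 1) (hk : 0 < k) :
    ∃ c : ℝ≥0∞, c ≠ ∞ ∧
      (μHE[n] : Measure E).restrict {z : E | ‖V.orthogonalProjectionOnto z‖ = 1} =
        c • Measure.map (fun p : V × Vᗮ ↦ (p.1 : E) + (p.2 : E))
          (((μHE[k] : Measure V).restrict (sphere 0 1)).prod (volume : Measure Vᗮ)) := by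
  -- notation
  set Cyl : Set E := {z : E | ‖V.orthogonalProjectionOnto z‖ = 1} with hCyl
  set σ : Measure V := (μHE[k] : Measure V).restrict (sphere 0 1) with hσ
  have hσfin : (μHE[k] : Measure V) (sphere 0 1) < ⊤ := euclideanHausdorffMeasure_sphere_lt_top hV 1
  haveI : IsFiniteMeasure σ := ⟨by rw [hσ, Measure.restrict_apply_univ]; exact hσfin⟩
  set f : V × Vᗮ → E := fun p ↦ (p.1 : E) + (p.2 : E) with hf_def
  have hf : Measurable f := by simp only [hf_def]; fun_prop
  set ν : Measure E := Measure.map f (σ.prod (volume : Measure Vᗮ)) with hν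
  have hCylm : MeasurableSet Cyl := measurableSet_cylinder V
  have hme : MeasurableEmbedding (Subtype.val : Cyl → E) := MeasurableEmbedding.subtype_coe hCylm
  -- the two measures on the subtype
  set μ₁ : Measure Cyl := (μHE[n] : Measure E).comap Subtype.val with hμ₁
  set μ₂ : Measure Cyl := ν.comap Subtype.val with hμ₂
  have hμ₁ball : ∀ (x : Cyl) (r : ℝ), μ₁ (ball x r) = (μHE[n] : Measure E) (Cyl ∩ ball (x : E) r) := by
    intro x r; rw [hμ₁, hme.comap_apply, image_val_ball_cylinder]
  have hμ₂ball : ∀ (x : Cyl) (r : ℝ), μ₂ (ball x r) = ν (Cyl ∩ ball (x : E) r) := by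
    intro x r; rw [hμ₂, hme.comap_apply, image_val_ball_cylinder]
  -- uniform distribution
  have hunif₁ : ∀ (x y : Cyl) (r : ℝ), μ₁ (ball x r) = μ₁ (ball y r) := by
    intro x y r
    obtain ⟨A, L, b, hL, hxy⟩ := exists_isometryEquiv_cylinder V x.2 y.2
    rw [hμ₁ball, hμ₁ball, ← hxy, ← image_cylinder_inter_ball V A hL b (x : E) r]
    have hiso : Isometry (fun z : E ↦ L z + (b : E)) :=
      (L.toIsometryEquiv.trans (IsometryEquiv.addRight (b : E))).isometry
    exact (hiso.euclideanHausdorffMeasure_image _).symm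
  have hunif₂ : ∀ (x y : Cyl) (r : ℝ), μ₂ (ball x r) = μ₂ (ball y r) := by
    intro x y r
    obtain ⟨A, L, b, hL, hxy⟩ := exists_isometryEquiv_cylinder V x.2 y.2
    rw [hμ₂ball, hμ₂ball, ← hxy, ← image_cylinder_inter_ball V A hL b (x : E) r]
    set g : E ≃ᵢ E := L.toIsometryEquiv.trans (IsometryEquiv.addRight (b : E)) with hg_def
    have hfun : (fun z : E ↦ L z + (b : E)) = g := funext fun z ↦ rfl
    have hinv : Measure.map g ν = ν := by
      rw [← hfun, hν, hf_def]
      exact map_cylinderIsometry_productMeasure V A hL b k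
    have hinv' : Measure.map g.symm ν = ν := by
      have hid : ((g.symm : E → E) ∘ (g : E → E)) = id := funext fun z ↦ g.symm_apply_apply z
      calc Measure.map g.symm ν = Measure.map g.symm (Measure.map g ν) := by rw [hinv]
        _ = Measure.map ((g.symm : E → E) ∘ (g : E → E)) ν :=
            Measure.map_map g.symm.continuous.measurable g.continuous.measurable
        _ = ν := by rw [hid, Measure.map_id]
    have hS : MeasurableSet (Cyl ∩ ball (x : E) r) := hCylm.inter measurableSet_ball
    have himg : (g : E → E) '' (Cyl ∩ ball (x : E) r) = g.symm ⁻¹' (Cyl ∩ ball (x : E) r) :=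
      g.toEquiv.image_eq_preimage_symm _
    rw [hfun, himg, ← Measure.map_apply g.symm.continuous.measurable hS, hinv']
  -- finiteness of balls
  have hfin₁ : ∀ (x : Cyl) (r : ℝ), μ₁ (ball x r) ≠ ∞ := fun x r ↦ by
    rw [hμ₁ball]
    exact (euclideanHausdorffMeasure_cylinder_inter_ball_lt_top' hE hV (x : E) r).ne
  have hfin₂ : ∀ (x : Cyl) (r : ℝ), μ₂ (ball x r) ≠ ∞ := by
    intro x r
    rw [hμ₂ball]
    refine ne_top_of_le_ne_top ?_ (measure_mono inter_subset_right)
    rw [hν, Measure.map_apply hf measurableSet_ball]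
    have hsub : f ⁻¹' ball (x : E) r ⊆ univ ×ˢ ball (Vᗮ.orthogonalProjectionOnto (x : E)) r := by
      rintro ⟨a, w⟩ hp
      simp only [mem_preimage, mem_ball, hf_def] at hp
      refine ⟨mem_univ _, ?_⟩
      rw [mem_ball, dist_eq_norm]
      have h1 : Vᗮ.orthogonalProjectionOnto ((a : E) + (w : E) - x) = w - Vᗮ.orthogonalProjectionOnto (x : E) := by
        rw [map_sub, map_add, orthogonalProjectionOnto_orthogonal_apply_eq_zero a.2, zero_add,
          orthogonalProjectionOnto_mem_subspace_eq_self]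
      rw [← h1]
      refine (norm_orthogonalProjectionOnto_apply_le _ _).trans_lt ?_
      rwa [← dist_eq_norm]
    refine ne_top_of_le_ne_top ?_ (measure_mono hsub)
    rw [Measure.prod_prod]
    exact ENNReal.mul_ne_top (measure_ne_top _ _) measure_ball_lt_top.ne
  -- `μ₂ ≠ 0`
  have hν0 : μ₂ ≠ 0 := by
    intro h0
    have h1 : μ₂ univ = 0 := by rw [h0, Measure.coe_zero, Pi.zero_apply]
    rw [hμ₂, hme.comap_apply, image_univ, Subtype.range_coe, hν, Measure.map_apply hf hCylm] at h1
    have hsub : sphere (0 : V) 1 ×ˢ (univ : Set Vᗮ) ⊆ f ⁻¹' Cyl := by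
      rintro ⟨a, w⟩ ⟨ha, -⟩
      simp only [mem_preimage, hCyl, mem_setOf_eq, hf_def, map_add,
        orthogonalProjectionOnto_mem_subspace_eq_self,
        orthogonalProjectionOnto_apply_of_mem_orthogonal w.2, add_zero]
      exact mem_sphere_zero_iff_norm.1 ha
    have h2 : (σ.prod (volume : Measure Vᗮ)) (sphere (0 : V) 1 ×ˢ (univ : Set Vᗮ)) = 0 :=
      le_antisymm ((measure_mono hsub).trans h1.le) bot_le
    rw [Measure.prod_prod, hσ, Measure.restrict_apply_self, mul_eq_zero] at h2
    rcases h2 with h2 | h2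
    · exact (euclideanHausdorffMeasure_unitSphere_pos hV hk).ne' h2
    · exact (NeZero.ne (volume (univ : Set Vᗮ))) h2
  -- Christensen
  obtain ⟨c, hc, hcμ⟩ := exists_eq_smul_of_measure_ball_eq_of_ne_top μ₁ μ₂ hunif₁ hunif₂ hfin₁ hfin₂ hν0
  refine ⟨c, hc, ?_⟩
  -- push forward to `E`
  have h1 : (μHE[n] : Measure E).restrict Cyl = μ₁.map Subtype.val := by
    rw [hμ₁, hme.map_comap, Subtype.range_coe]
  have hνCyl : ν.restrict Cyl = ν := by
    refine Measure.restrict_eq_self_of_ae_mem ?_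
    rw [hν, ae_map_iff hf.aemeasurable (p := fun x ↦ x ∈ Cyl) hCylm]
    have : ∀ᵐ p ∂(σ.prod (volume : Measure Vᗮ)), p.1 ∈ sphere (0 : V) 1 := by
      refine (ae_prod_mem_iff_ae_ae_mem (measurable_fst isClosed_sphere.measurableSet :
        MeasurableSet (Prod.fst ⁻¹' sphere (0 : V) 1))).2 ?_
      rw [hσ]
      filter_upwards [ae_restrict_mem isClosed_sphere.measurableSet] with a ha
      exact ae_of_all _ fun _ ↦ ha
    filter_upwards [this] with p hp
    simp only [hCyl, mem_setOf_eq, hf_def, map_add, orthogonalProjectionOnto_mem_subspace_eq_self,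
      orthogonalProjectionOnto_apply_of_mem_orthogonal p.2.2, add_zero]
    exact mem_sphere_zero_iff_norm.1 hp
  have h2 : μ₂.map Subtype.val = ν := by
    rw [hμ₂, hme.map_comap, Subtype.range_coe, hνCyl]
  rw [h1, hcμ, Measure.map_smul, h2]

end Proportional

end Literature.MeasureTheory.Hausdorff

end
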